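import Literature.MathematicalPhysics.QuantumLattice.GibbsStationaritySlack
import HarnessLib

/-!
# The zero-response slice of a sourced KKT/positivity program is nested in the field

Topic `MathematicalPhysics/QuantumLattice` (family `hubbard`; cell `hubbard-cq`, card
`sourced-kkt-one-point-floor`, job K's verdict logic «ONE feasibility solve at the largest field decides the
zero-response question for every smaller field», critic-2 verdict §2b). Two model-free matrix lemmas over
Mathlib's `Matrix.PosSemidef` and their corollary.

Setting. A relaxation at source strength `h` imposes a positivity constraint `M₀ - h·P ⪰ 0` on each candidate
point, where `M₀` is the source-free part of the moment/KKT form and `P` the source part. For a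
`U(1)`-INVARIANT candidate (the "zero-response" points: every charged word has zero expectation) the charge
grading `D` (the unitary phase `e^{iπq/2}` on the charge-`q` blocks) FIXES `M₀` (block-diagonal in charge) and
FLIPS `P` (off-diagonal by charge `±2`): `D M₀ Dᴴ = M₀`, `D P Dᴴ = -P`.

* `posSemidef_add_smul_of_grading_flip` (Z1, GRADING FLIP): `D M₀ Dᴴ = M₀`, `D P Dᴴ = -P`,
  `M₀ - h·P ⪰ 0` ⇒ `M₀ + h·P ⪰ 0` (congruence preserves the cone; no unitarity of `D` needed).
* `posSemidef_sub_smul_of_abs_le` (Z2, CONVEXITY): `M₀ + h₁P ⪰ 0` and `M₀ - h₁P ⪰ 0` ⇒ `M₀ - hP ⪰ 0` for every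
  `|h| ≤ h₁` (convexity of the cone).
* `posSemidef_sub_smul_of_grading_flip_of_abs_le` (COROLLARY, NESTING): under the grading hypotheses,
  `M₀ - h₁P ⪰ 0` ⇒ `M₀ - hP ⪰ 0` for all `|h| ≤ h₁`; family form `zeroResponseSlice_nested`: for a family of
  candidates `ω ↦ (M₀ ω, P ω)` all fixed/flipped by one grading, the feasible slice at field `h₁` is contained
  in the feasible slice at every `|h| ≤ h₁`.
* `firstOrderRow_sub_smul_source` — the first-order (Ward/stationarity) rows are `h`-INDEPENDENT on such
  candidates: for a linear functional `ω` with `ω(OX - XO) = 0` (a definite-charge `X` against the charge-`±2`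
  source `O`, in a `U(1)`-invariant `ω`), `ω((H₀ - hO)X - X(H₀ - hO)) = ω(H₀X - XH₀)`.

Instantiation (remark, exact hypotheses; the certificate objects of `DWaveSourceNNNHoppingWindowCertificateKKT`
are identity-based and need no change): for the level-`X` sourced one-point program of the card at field `h`
with words `B`, `M₀(ω̃) = (ω̃(B_i†B_j))` restricted to its `U(1)`-invariant part plus the source-free KKT block,
`P(ω̃)` the source KKT block; `D = diag(i^{q(B_i)})`. Then Z1+Z2 give `Z(h₁) ⊆ Z(h)` for `0 ≤ h ≤ h₁`, where
`Z(h)` is the set of `U(1)`-invariant feasible points at field `h`; hence «`m_lo(h₁) ≤ 0` witnessed by a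
symmetric point ⇒ `m_lo(h) ≤ 0` for all `h ≤ h₁`». No definition and no named fact is introduced.

## References
* G. Blekherman, P. A. Parrilo, R. R. Thomas (eds.), *Semidefinite Optimization and Convex Algebraic
  Geometry* (2012), App. A (the PSD cone: convexity, invariance under congruence) [BlekhermanParriloThomas2012].
* S. Boyd, L. Vandenberghe, *Convex Optimization* (2004), §2.2.5 (the positive semidefinite cone)
  [BoydVandenberghe2004].
* M. Araújo et al., arXiv:2311.18707, §3.2 Prop. 11 [AraujoEtAl2023] (state-optimality / KKT rows).
-/

noncomputable section

open Matrix
open scoped ComplexOrder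

namespace Literature.MathematicalPhysics.QuantumLattice

variable {n : Type*} [Fintype n]

/-! ### Z1: the grading flip -/

/-- **Z1 (grading flip).** If `D M₀ Dᴴ = M₀` and `D P Dᴴ = -P`, then `M₀ - h·P ⪰ 0` implies `M₀ + h·P ⪰ 0`:
`D(M₀ - hP)Dᴴ = M₀ + hP` and congruence preserves positive semidefiniteness.
[cite: BlekhermanParriloThomas2012, App. A] -/
theorem posSemidef_add_smul_of_grading_flip {M₀ P D : Matrix n n ℂ} (hM : D * M₀ * Dᴴ = M₀)
    (hP : D * P * Dᴴ = -P) {h : ℂ} (hpsd : (M₀ - h • P).PosSemidef) : (M₀ + h • P).PosSemidef := by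
  have hconj : D * (M₀ - h • P) * Dᴴ = M₀ + h • P := by
    rw [Matrix.mul_sub, Matrix.sub_mul, Matrix.mul_smul, Matrix.smul_mul, hM, hP, smul_neg, sub_neg_eq_add]
  rw [← hconj]
  exact hpsd.mul_mul_conjTranspose_same D

/-- **Z1, symmetric form**: under the grading hypotheses `M₀ + h·P ⪰ 0 ↔ M₀ - h·P ⪰ 0`.
[cite: BlekhermanParriloThomas2012, App. A] -/
theorem posSemidef_add_smul_iff_of_grading_flip {M₀ P D : Matrix n n ℂ} (hM : D * M₀ * Dᴴ = M₀)
    (hP : D * P * Dᴴ = -P) (h : ℂ) : (M₀ + h • P).PosSemidef ↔ (M₀ - h • P).PosSemidef := by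
  refine ⟨fun hp => ?_, posSemidef_add_smul_of_grading_flip hM hP⟩
  have h' := posSemidef_add_smul_of_grading_flip (h := -h) hM hP (by rwa [neg_smul, sub_neg_eq_add])
  rwa [neg_smul, ← sub_eq_add_neg] at h'

/-! ### Z2: convexity in the field -/

omit [Fintype n] in
/-- Nonnegative real combinations stay in the cone. [cite: BoydVandenberghe2004, §2.2.5] -/
private theorem posSemidef_smul_add_smul [Fintype n] {A B : Matrix n n ℂ} (hA : A.PosSemidef)
    (hB : B.PosSemidef) {a b : ℝ} (ha : 0 ≤ a) (hb : 0 ≤ b) : ((a : ℂ) • A + (b : ℂ) • B).PosSemidef :=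
  (hA.smul (Complex.zero_le_real.2 ha)).add (hB.smul (Complex.zero_le_real.2 hb))

/-- **Z2 (convexity).** If `M₀ + h₁P ⪰ 0` and `M₀ - h₁P ⪰ 0`, then `M₀ - hP ⪰ 0` for every real `h` with
`|h| ≤ h₁`: `M₀ - hP = λ(M₀ - h₁P) + (1-λ)(M₀ + h₁P)`, `λ = (h₁ + h)/(2h₁) ∈ [0, 1]`.
[cite: BoydVandenberghe2004, §2.2.5] [cite: BlekhermanParriloThomas2012, App. A] -/
theorem posSemidef_sub_smul_of_abs_le {M₀ P : Matrix n n ℂ} {h₁ h : ℝ}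
    (hplus : (M₀ + (h₁ : ℂ) • P).PosSemidef) (hminus : (M₀ - (h₁ : ℂ) • P).PosSemidef) (hh : |h| ≤ h₁) :
    (M₀ - (h : ℂ) • P).PosSemidef := by
  rcases eq_or_lt_of_le (le_trans (abs_nonneg h) hh) with h0 | hpos
  · -- `h₁ = 0`, hence `h = 0`
    have hz : h = 0 := abs_eq_zero.1 (le_antisymm (h0 ▸ hh) (abs_nonneg h))
    subst hz
    rw [← h0] at hminus
    simpa using hminus
  · set lam : ℝ := (h₁ + h) / (2 * h₁) with hlam
    have hl0 : 0 ≤ lam := div_nonneg (by linarith [neg_abs_le h, hh]) (by linarith)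
    have hl1 : 0 ≤ 1 - lam := by
      rw [hlam, sub_nonneg, div_le_one (by linarith)]
      linarith [le_abs_self h, hh]
    have hcomb : (lam : ℂ) • (M₀ - (h₁ : ℂ) • P) + ((1 - lam : ℝ) : ℂ) • (M₀ + (h₁ : ℂ) • P) =
        M₀ - (h : ℂ) • P := by
      have hcoef : (lam : ℂ) * h₁ * (-1) + ((1 - lam : ℝ) : ℂ) * h₁ = -(h : ℂ) := by
        have h2 : (2 * h₁) ≠ 0 := by positivity
        have : lam * h₁ * (-1) + (1 - lam) * h₁ = -h := by
          rw [hlam]; field_simp; ring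
        exact_mod_cast this
      have hone : (lam : ℂ) + ((1 - lam : ℝ) : ℂ) = 1 := by push_cast; ring
      calc (lam : ℂ) • (M₀ - (h₁ : ℂ) • P) + ((1 - lam : ℝ) : ℂ) • (M₀ + (h₁ : ℂ) • P)
          = ((lam : ℂ) + ((1 - lam : ℝ) : ℂ)) • M₀ +
              ((lam : ℂ) * h₁ * (-1) + ((1 - lam : ℝ) : ℂ) * h₁) • P := by
            simp only [smul_sub, smul_add, smul_smul, add_smul]
            module
        _ = M₀ - (h : ℂ) • P := by rw [hone, hcoef, one_smul, neg_smul, sub_eq_add_neg]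
    rw [← hcomb]
    exact posSemidef_smul_add_smul hminus hplus hl0 hl1

/-! ### Corollary: the zero-response slice is nested downward -/

/-- **Nesting from one field.** Under the grading hypotheses (`D M₀ Dᴴ = M₀`, `D P Dᴴ = -P`),
feasibility at field `h₁` implies feasibility at every field of smaller size:
`M₀ - h₁P ⪰ 0 ⇒ M₀ - hP ⪰ 0` for all `|h| ≤ h₁` (Z1 supplies `M₀ + h₁P ⪰ 0`, then Z2).
[cite: BlekhermanParriloThomas2012, App. A] [cite: BoydVandenberghe2004, §2.2.5] -/
theorem posSemidef_sub_smul_of_grading_flip_of_abs_le {M₀ P D : Matrix n n ℂ} (hM : D * M₀ * Dᴴ = M₀)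
    (hP : D * P * Dᴴ = -P) {h₁ h : ℝ} (hfeas : (M₀ - (h₁ : ℂ) • P).PosSemidef) (hh : |h| ≤ h₁) :
    (M₀ - (h : ℂ) • P).PosSemidef :=
  posSemidef_sub_smul_of_abs_le (posSemidef_add_smul_of_grading_flip hM hP hfeas) hfeas hh

/-- **The zero-response slice is nested downward in the field.** For a family of candidate points
`ω : ι` with source-free part `M₀ ω` and source part `P ω`, all fixed/flipped by one grading `D`
(`U(1)`-invariant candidates under the charge grading), the set of candidates feasible for the positivity
constraint at field `h₁` is contained in the feasible set at every `|h| ≤ h₁`. (The remaining rows of a sourced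
KKT program — first-order Ward rows and charge-diagonal blocks — are `h`-independent on such candidates,
`firstOrderRow_sub_smul_source`.) [cite: AraujoEtAl2023, §3.2 Prop. 11] [cite: BoydVandenberghe2004, §2.2.5] -/
theorem zeroResponseSlice_nested {ι : Type*} (M₀ P : ι → Matrix n n ℂ) (D : Matrix n n ℂ)
    (hM : ∀ ω, D * M₀ ω * Dᴴ = M₀ ω) (hP : ∀ ω, D * P ω * Dᴴ = -(P ω)) {h₁ h : ℝ} (hh : |h| ≤ h₁) :
    {ω | (M₀ ω - (h₁ : ℂ) • P ω).PosSemidef} ⊆ {ω | (M₀ ω - (h : ℂ) • P ω).PosSemidef} :=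
  fun ω hω => posSemidef_sub_smul_of_grading_flip_of_abs_le (hM ω) (hP ω) hω hh

/-! ### The first-order rows do not see the source on `U(1)`-invariant candidates -/

/-- **First-order rows are `h`-independent on symmetric candidates.** For a linear functional `ω` on
matrices with `ω(OX - XO) = 0` (a definite-charge test word `X` against the charge-`±2` source `O` in a
`U(1)`-invariant `ω`), the stationarity row of `H₀ - h·O` equals that of `H₀`:
`ω((H₀ - hO)X - X(H₀ - hO)) = ω(H₀X - XH₀)`. [cite: AraujoEtAl2023, §3.2 Prop. 11] -/
theorem firstOrderRow_sub_smul_source (ω : Matrix n n ℂ →ₗ[ℂ] ℂ) {H₀ O X : Matrix n n ℂ} (h : ℂ)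
    (hOX : ω (O * X - X * O) = 0) :
    ω ((H₀ - h • O) * X - X * (H₀ - h • O)) = ω (H₀ * X - X * H₀) := by
  have hexp : (H₀ - h • O) * X - X * (H₀ - h • O) = (H₀ * X - X * H₀) - h • (O * X - X * O) := by
    rw [Matrix.sub_mul, Matrix.mul_sub, Matrix.smul_mul, Matrix.mul_smul, smul_sub]
    abel
  rw [hexp, map_sub, map_smul, hOX, smul_zero, sub_zero]

end Literature.MathematicalPhysics.QuantumLattice
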